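import Summits.KontsevichZagierPeriods.KontsevichZagierPeriods.Theses.RootDecompRationalCubeDichotomy
import Summits.KontsevichZagierPeriods.KontsevichZagierPeriods.Theorems.RootDecompRationalCubeDichotomySectorMerge
import Summits.KontsevichZagierPeriods.KontsevichZagierPeriods.Theorems.SoloInformedPiDisc
import Literature.NumberTheory.Transcendental.KZCubeRationalMoves
import Literature.NumberTheory.Transcendental.KZProductIdeal

/-!
# Route RootDecompRationalCubeDichotomy — `PiTimesSector` (item stmt-KontsevichZagierPeriods-26388)

THEOREM-type support: `[π] · y ∈ relations ⊔ ⟨rational closed-cube sector⟩` for every generator `y`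
of the sector.

Proof (= `piTimesSector_of_piInSector ∘ piInSector_of_arctanRep` of the decomp-kz lens-2 node file
`run/shared/lean/pub/decomp-kz/decomp-kz-lens-2/g3/RationalCubeDichotomy.lean`, gen 3):
(1) `[π] − 4·[[0,1], 1/(1+t²)] ∈ relations` is the tree theorem
`Theorems.soloInformed_piRep_sub_four_nsmul_arctanRep_mem_relations` (Kontsevich–Zagier §1.1 inside
the four-move calculus), and `[[0,1], 1/(1+t²)]` is a sector generator (`P = 1`, `Q = 1 + X₀²`), so
`[π] ∈ relations ⊔ ⟨sector⟩`; (2) the sector is closed under products modulo relations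
(`KZ.RFun.rel_tensor` + `KZ.mul_sub_mul_mem_relations`), and `relations` is a right ideal
(`KZ.mul_mem_relations_right_holds`); hence `[π]·y = ρ·y + s·y ∈ relations ⊔ ⟨sector⟩`.

FARM NOTE: needs `KZCubeRationalMoves` and `Theorems.SoloInformedPiDisc` built (both unbuilt on the
snapshot of 2026-08-30 03:00Z, rc 75) and the sibling file `RootDecompRationalCubeDichotomySectorMerge`
(= g3/SectorMerge26323.lean) landed first.
-/

namespace Summit.KontsevichZagierPeriods.RootDecompRationalCubeDichotomy

open MvPolynomial
open Literature.NumberTheory.Transcendental Literature.NumberTheory.Transcendental.KZ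

/-- The sector is closed under products modulo relations. -/
theorem mul_mem_sup_of_mem_ratCubeSet {y₁ y₂ : FormalRep} (hy₁ : y₁ ∈ ratCubeSet) (hy₂ : y₂ ∈ ratCubeSet) :
    y₁ * y₂ ∈ relations ⊔ AddSubgroup.closure ratCubeSet := by
  obtain ⟨m, T, hT⟩ := exists_rfun_of_mem_ratCubeSet hy₁
  obtain ⟨n, S, hS⟩ := exists_rfun_of_mem_ratCubeSet hy₂
  have h1 : y₁ * y₂ - of T.rep * of S.rep ∈ relations := mul_sub_mul_mem_relations hT hS
  have h2 : of T.rep * of S.rep - of (T.tensor S).rep ∈ relations := RFun.rel_tensor T S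
  have e : y₁ * y₂ = (y₁ * y₂ - of T.rep * of S.rep) + (of T.rep * of S.rep - of (T.tensor S).rep)
      + of (T.tensor S).rep := by abel
  rw [e]
  exact add_mem (AddSubgroup.mem_sup_left (add_mem h1 h2))
    (AddSubgroup.mem_sup_right (AddSubgroup.subset_closure (rfun_rep_mem_ratCubeSet _)))

/-- The generated subgroup times a generator stays in `relations ⊔ ⟨sector⟩`. -/
theorem mul_mem_sup_of_mem_closure {s y : FormalRep} (hs : s ∈ AddSubgroup.closure ratCubeSet)
    (hy : y ∈ ratCubeSet) : s * y ∈ relations ⊔ AddSubgroup.closure ratCubeSet := by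
  induction hs using AddSubgroup.closure_induction with
  | mem x hx => exact mul_mem_sup_of_mem_ratCubeSet hx hy
  | zero => rw [zero_mul]; exact zero_mem _
  | add x x' _ _ hx hx' => rw [add_mul]; exact add_mem hx hx'
  | neg x _ hx => rw [neg_mul]; exact neg_mem hx

/-- `[π] ∈ relations ⊔ ⟨sector⟩`, from the tree theorem `π = 4∫₀¹ dt/(1+t²)`. -/
theorem piRep_mem_sup : of piRep ∈ relations ⊔ AddSubgroup.closure ratCubeSet := by
  have hA : of Summit.KontsevichZagierPeriods.KontsevichZagierPeriods.Theorems.soloInformedArctanRep ∈ ratCubeSet := by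
    refine ⟨1, _, C 1, 1 + X 0 ^ 2, ?_, fun z _ => ?_, fun z _ => ?_, rfl⟩
    · ext x
      simp only [Summit.KontsevichZagierPeriods.KontsevichZagierPeriods.Theorems.soloInformedArctanRep_domain,
        Summit.KontsevichZagierPeriods.KontsevichZagierPeriods.Theorems.soloInformedUnitI,
        Set.mem_setOf_eq, Set.mem_pi, Set.mem_univ, forall_const, Set.mem_Icc, Fin.forall_fin_one]
    · simp only [map_add, map_one, map_pow, aeval_X]
      positivity
    · rw [Summit.KontsevichZagierPeriods.KontsevichZagierPeriods.Theorems.soloInformedArctanRep_integrand]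
      simp
  have e : of piRep = (of piRep - 4 • of Summit.KontsevichZagierPeriods.KontsevichZagierPeriods.Theorems.soloInformedArctanRep)
      + 4 • of Summit.KontsevichZagierPeriods.KontsevichZagierPeriods.Theorems.soloInformedArctanRep := by abel
  rw [e]
  exact add_mem (AddSubgroup.mem_sup_left
      Summit.KontsevichZagierPeriods.KontsevichZagierPeriods.Theorems.soloInformed_piRep_sub_four_nsmul_arctanRep_mem_relations)
    (AddSubgroup.mem_sup_right (AddSubgroup.nsmul_mem _ (AddSubgroup.subset_closure hA) 4))

/-- **PiTimesSector** (item stmt-KontsevichZagierPeriods-26388) holds — stated with the item's signature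
VERBATIM (the route file at rev 1 does not yet render `def PiTimesSector`; once it does,
`theorem piTimesSector_holds : …Theses.RootDecompRationalCubeDichotomy.PiTimesSector := piTimesSector_proof`). -/
theorem piTimesSector_proof :
    ∀ y ∈ {x : Literature.NumberTheory.Transcendental.KZ.FormalRep | ∃ (m : ℕ) (q : Literature.NumberTheory.Transcendental.KZ.IntegralRep m) (P Q : MvPolynomial (Fin m) ℚ), q.domain = Set.pi Set.univ (fun _ : Fin m => Set.Icc (0:ℝ) 1) ∧ (∀ z ∈ Set.pi Set.univ (fun _ : Fin m => Set.Icc (0:ℝ) 1), MvPolynomial.aeval z Q ≠ 0) ∧ (∀ z ∈ Set.pi Set.univ (fun _ : Fin m => Set.Icc (0:ℝ) 1), q.integrand z = MvPolynomial.aeval z P / MvPolynomial.aeval z Q) ∧ x = Literature.NumberTheory.Transcendental.KZ.of q}, Literature.NumberTheory.Transcendental.KZ.of Literature.NumberTheory.Transcendental.KZ.piRep * y ∈ Literature.NumberTheory.Transcendental.KZ.relations ⊔ AddSubgroup.closure {x : Literature.NumberTheory.Transcendental.KZ.FormalRep | ∃ (m : ℕ) (q : Literature.NumberTheory.Transcendental.KZ.IntegralRep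 m) (P Q : MvPolynomial (Fin m) ℚ), q.domain = Set.pi Set.univ (fun _ : Fin m => Set.Icc (0:ℝ) 1) ∧ (∀ z ∈ Set.pi Set.univ (fun _ : Fin m => Set.Icc (0:ℝ) 1), MvPolynomial.aeval z Q ≠ 0) ∧ (∀ z ∈ Set.pi Set.univ (fun _ : Fin m => Set.Icc (0:ℝ) 1), q.integrand z = MvPolynomial.aeval z P / MvPolynomial.aeval z Q) ∧ x = Literature.NumberTheory.Transcendental.KZ.of q} := by
  intro y hy
  obtain ⟨ρ, hρ, s, hs, hρs⟩ := AddSubgroup.mem_sup.mp piRep_mem_sup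
  rw [← hρs, add_mul]
  exact add_mem (AddSubgroup.mem_sup_left (mul_mem_relations_right_holds ρ y hρ))
    (mul_mem_sup_of_mem_closure hs hy)

end Summit.KontsevichZagierPeriods.RootDecompRationalCubeDichotomy
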